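import Literature.Topology.LocallyConstantExtend      -- ★ `exists_isLocallyConstant_hasCompactSupport_extend` (restriction `S(X) → S(C)` is onto, any subset `C`)
import Mathlib.Topology.Homeomorph.Lemmas
import HarnessLib

/-!
# The `ℓ`-space short exact sequence `0 → S(U) → S(X) → S(Z) → 0`: extension by zero from an open set, restriction to a closed set,
# the kernel, and the relative lift (Bernstein–Zelevinsky 1976, §1.1–§1.3, Prop. 1.8)

Topic `Topology`; namespace `Literature.Topology`.  THEOREMS ONLY (no definition, no instance, no notation, no named fact, no `sorry`); Mathlib + ★
`LocallyConstantExtend` only.  Cell `pub/hodgecm-mathlib` (D-0151), crux H413 = `stmt-HodgeConjecture-24833`, line LH4 (Shalika pay-down), organ «LIFT-EXACT» =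
SPAN FILE A (LH4-plan (g2) dealer words #6 (a)); the brick that the Howe induction (SPAN-e, `OrbitalIntegralKernelDecomposition`, LH7-p01 (g2)) consumes by name.

THE MATHEMATICS.  `X` a Hausdorff topological space; `S(A)` = the locally constant compactly supported functions on a subspace `A` (values in any `Y` with `0`);
`Z ⊆ X` closed, `U = X ∖ Z` open.  Currency = ★ `LocallyConstantExtend` :82: functions on SUBTYPES `f : ↥A → Y`, extensions `F : X → Y` with `F x = f x` for `x : ↥A`.
* §1 (L1) EXTENSION BY ZERO from an OPEN `U`: for `f ∈ S(U)`, `Function.extend Subtype.val f 0 : X → Y` is locally constant with compact support, its `tsupport` lies in `U`,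
  it restricts to `f` on `U` and vanishes off `U` (`S(U) ↪ S(X)`); packaged as `exists_extend_zero_of_isOpen`.  (The image of `tsupport f` is compact, hence CLOSED in
  the Hausdorff `X` — this is where `T2Space` is used.)
* §2 (L2) RESTRICTION to a CLOSED `Z`: `F ∈ S(X) ⇒ F ∘ val ∈ S(Z)` (Mathlib `HasCompactSupport.comp_isClosedEmbedding`).
* §3 (L3) KERNEL: for locally constant `F`, `tsupport F = support F` (the support is clopen), so `F|_Z = 0 ⟺ tsupport F ∩ Z = ∅`, and then `F` IS the extension by
  zero of its restriction to `Zᶜ` (exactness in the middle); UNIQUENESS of a function with prescribed restriction to `U` and vanishing off `U` (⇒ equivariance of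
  the extension under any bijection preserving `U`, e.g. conjugation — (L5)).
* §4 (L4) SURJECTIVITY is ★ `exists_isLocallyConstant_hasCompactSupport_extend` (not restated); the RELATIVE LIFT for a closed pair `Z' ⊆ Z`: every
  `f ∈ S(Z ∖ Z')` is the restriction of some `F ∈ S(X)` VANISHING ON `Z'` (extend by zero inside `Z`, then ★ :82) — the induction step of the orbit-stratum
  argument ([BernsteinZelevinsky1976, §1.5]; [Rogawski1990, p. 113]).
HONEST LABEL: pure topology, count-neutral, pays no letter; HC_CM is proved only modulo the 7 printed citations (2 remaining: hLiu418 = stmt-HodgeConjecture-24832,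
h413 = stmt-HodgeConjecture-24833) until rung 0 closes.

## References
* [BernsteinZelevinsky1976] I. N. Bernstein, A. V. Zelevinsky, *Representations of the group GL(n, F) where F is a non-archimedean local field*, Russian Math.
  Surveys 31:3 (1976) 1–68: §1.1–§1.3 (`ℓ`-spaces, `S(X)`), Prop. 1.8 (exactness of `0 → S(U) → S(X) → S(Z) → 0`).
-/

set_option autoImplicit false

open Set Filter Topology Function

namespace Literature.Topology

/-! ## §1 (L1) Extension by zero from an open set -/

section ExtendZeroAlgebra

variable {X : Type*} {Y : Type*} [Zero Y]

/-- On `U`, the extension by zero restricts to `f`. [cite: BernsteinZelevinsky1976, §1.1] -/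
theorem extend_zero_apply_coe {U : Set X} (f : ↥U → Y) (x : ↥U) : Function.extend Subtype.val f 0 x = f x :=
  Subtype.val_injective.extend_apply _ _ _

/-- Off `U`, the extension by zero vanishes. [cite: BernsteinZelevinsky1976, §1.1] -/
theorem extend_zero_apply_of_not_mem {U : Set X} (f : ↥U → Y) {x : X} (hx : x ∉ U) : Function.extend Subtype.val f 0 x = 0 := by
  rw [Function.extend_apply' _ _ _ (fun ⟨y, hy⟩ => hx (hy ▸ y.2))]
  rfl

/-- The support of the extension by zero is the image of the support. [cite: BernsteinZelevinsky1976, §1.1] -/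
theorem support_extend_zero {U : Set X} (f : ↥U → Y) :
    Function.support (Function.extend Subtype.val f 0) = Subtype.val '' Function.support f := by
  ext x
  simp only [Function.mem_support, Set.mem_image]
  constructor
  · intro hx
    by_cases hxU : x ∈ U
    · refine ⟨⟨x, hxU⟩, fun h0 => hx ?_, rfl⟩
      rw [← extend_zero_apply_coe f ⟨x, hxU⟩] at h0
      exact h0
    · exact (hx (extend_zero_apply_of_not_mem f hxU)).elim
  · rintro ⟨y, hy, rfl⟩
    rwa [extend_zero_apply_coe]

/-- **UNIQUENESS**: a function is determined by its restriction to `U` and its vanishing off `U`. [cite: BernsteinZelevinsky1976, §1.1] -/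
theorem eq_of_forall_coe_eq_of_forall_not_mem {U : Set X} {F F' : X → Y} (hU : ∀ x : ↥U, F x = F' x) (hU' : ∀ x ∉ U, F x = 0)
    (hU'' : ∀ x ∉ U, F' x = 0) : F = F' := by
  funext x
  by_cases hx : x ∈ U
  · exact hU ⟨x, hx⟩
  · rw [hU' x hx, hU'' x hx]

/-- **EXACTNESS IN THE MIDDLE (algebraic half)**: a function vanishing on `Z` IS the extension by zero of its restriction to `Zᶜ`.
[cite: BernsteinZelevinsky1976, §1.3 Prop. 1.8] -/
theorem eq_extend_zero_restrict_compl_of_forall_mem_eq_zero {F : X → Y} {Z : Set X} (h : ∀ x ∈ Z, F x = 0) :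
    F = Function.extend Subtype.val (F ∘ (Subtype.val : ↥Zᶜ → X)) 0 :=
  eq_of_forall_coe_eq_of_forall_not_mem (U := Zᶜ) (fun y => (extend_zero_apply_coe (F ∘ (Subtype.val : ↥Zᶜ → X)) y).symm)
    (fun x hx => h x (not_notMem.1 hx)) (fun _ hx => extend_zero_apply_of_not_mem _ hx)

/-- **(L5) EQUIVARIANCE from uniqueness**: if a self-map `φ` of `X` satisfies `φ x ∈ U ↔ x ∈ U` (e.g. conjugation by a group element and a conjugation-stable
`U`), then the only function restricting to `x ↦ f (φ x)` on `U` and vanishing off `U` is `(Function.extend val f 0) ∘ φ` — transporting the data transports the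
extension by zero. [cite: BernsteinZelevinsky1976, §1.5] -/
theorem extend_zero_comp_eq {U : Set X} (f : ↥U → Y) (φ : X → X) (hφ : ∀ x, φ x ∈ U ↔ x ∈ U) {F' : X → Y}
    (hF'U : ∀ x : ↥U, F' x = f ⟨φ x, (hφ x).2 x.2⟩) (hF'c : ∀ x ∉ U, F' x = 0) : F' = Function.extend Subtype.val f 0 ∘ φ := by
  refine eq_of_forall_coe_eq_of_forall_not_mem (U := U) (fun x => ?_) hF'c (fun x hx => ?_)
  · rw [hF'U x]
    exact (extend_zero_apply_coe f ⟨φ x, (hφ x).2 x.2⟩).symm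
  · exact extend_zero_apply_of_not_mem f (fun h => hx ((hφ x).1 h))

end ExtendZeroAlgebra

section ExtendZero

variable {X : Type*} [TopologicalSpace X] {Y : Type*} [Zero Y]

/-- **(L1a)** The extension by zero of a compactly supported `f` on an open `U` vanishes off the compact (closed) image `K` of `tsupport f`, and `K ⊆ U`.
[cite: BernsteinZelevinsky1976, §1.1] -/
theorem extend_zero_eq_zero_of_not_mem_image {U : Set X} (f : ↥U → Y) {x : X} (hx : x ∉ Subtype.val '' tsupport f) :
    Function.extend Subtype.val f 0 x = 0 := by
  by_cases hxU : x ∈ U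
  · have h0 : f ⟨x, hxU⟩ = 0 := image_eq_zero_of_notMem_tsupport fun h => hx ⟨⟨x, hxU⟩, h, rfl⟩
    rw [← h0]
    exact extend_zero_apply_coe f ⟨x, hxU⟩
  · exact extend_zero_apply_of_not_mem f hxU

/-- **(L1b) The extension by zero is LOCALLY CONSTANT** (`U` open, `f` locally constant with compact support, `X` Hausdorff). [cite: BernsteinZelevinsky1976, §1.1–§1.3] -/
theorem isLocallyConstant_extend_zero [T2Space X] {U : Set X} (hU : IsOpen U) {f : ↥U → Y} (hf : IsLocallyConstant f) (hfs : HasCompactSupport f) :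
    IsLocallyConstant (Function.extend Subtype.val f 0) := by
  have hK : IsCompact (Subtype.val '' tsupport f) := hfs.image continuous_subtype_val
  refine (IsLocallyConstant.iff_eventually_eq _).2 fun x => ?_
  by_cases hxU : x ∈ U
  · -- near a point of `U`: `F = f ∘ val⁻¹`, and `val : U → X` is an open embedding
    have hev : ∀ᶠ y : ↥U in 𝓝 ⟨x, hxU⟩, f y = f ⟨x, hxU⟩ := hf.eventually_eq ⟨x, hxU⟩
    have hmap : map (Subtype.val : ↥U → X) (𝓝 ⟨x, hxU⟩) = 𝓝 x := hU.isOpenEmbedding_subtypeVal.map_nhds_eq ⟨x, hxU⟩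
    rw [← hmap, Filter.eventually_map]
    filter_upwards [hev] with y hy
    rw [extend_zero_apply_coe, hy]
    exact (extend_zero_apply_coe f ⟨x, hxU⟩).symm
  · -- near a point off `U`: off the closed image of `tsupport f`, `F = 0`
    have hxK : x ∉ Subtype.val '' tsupport f := fun ⟨y, _, hy⟩ => hxU (hy ▸ y.2)
    filter_upwards [hK.isClosed.isOpen_compl.mem_nhds hxK] with y hy
    rw [extend_zero_eq_zero_of_not_mem_image f hy, extend_zero_eq_zero_of_not_mem_image f hxK]

/-- **(L1c) The extension by zero has COMPACT SUPPORT** (`X` Hausdorff: the compact image of `tsupport f` is closed and the extension vanishes off it).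
[cite: BernsteinZelevinsky1976, §1.1] -/
theorem hasCompactSupport_extend_zero [T2Space X] {U : Set X} {f : ↥U → Y} (hfs : HasCompactSupport f) :
    HasCompactSupport (Function.extend Subtype.val f 0) := by
  refine HasCompactSupport.intro' (hfs.image continuous_subtype_val) (hfs.image continuous_subtype_val).isClosed fun x hx => ?_
  exact extend_zero_eq_zero_of_not_mem_image f hx

/-- **(L1d)** `tsupport (extension by zero) ⊆ val '' tsupport f ⊆ U`. [cite: BernsteinZelevinsky1976, §1.1] -/
theorem tsupport_extend_zero_subset [T2Space X] {U : Set X} {f : ↥U → Y} (hfs : HasCompactSupport f) :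
    tsupport (Function.extend Subtype.val f 0) ⊆ Subtype.val '' tsupport f := by
  rw [tsupport]
  refine closure_minimal (fun x hx => ?_) (hfs.image continuous_subtype_val).isClosed
  by_contra h
  exact hx (extend_zero_eq_zero_of_not_mem_image f h)

/-- **(L1d′)** `tsupport (extension by zero) ⊆ U`. [cite: BernsteinZelevinsky1976, §1.1] -/
theorem tsupport_extend_zero_subset_self [T2Space X] {U : Set X} {f : ↥U → Y} (hfs : HasCompactSupport f) :
    tsupport (Function.extend Subtype.val f 0) ⊆ U := fun x hx => by
  obtain ⟨y, -, rfl⟩ := tsupport_extend_zero_subset hfs hx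
  exact y.2

/-- **(L1) EXTENSION BY ZERO, packaged**: `f ∈ S(U)`, `U` open in the Hausdorff `X` ⇒ `∃ F ∈ S(X)` with `tsupport F ⊆ U`, `F|_U = f`, `F = 0` off `U`.
[cite: BernsteinZelevinsky1976, §1.3 Prop. 1.8] -/
theorem exists_extend_zero_of_isOpen [T2Space X] {U : Set X} (hU : IsOpen U) {f : ↥U → Y} (hf : IsLocallyConstant f) (hfs : HasCompactSupport f) :
    ∃ F : X → Y, IsLocallyConstant F ∧ HasCompactSupport F ∧ tsupport F ⊆ U ∧ (∀ x : ↥U, F x = f x) ∧ ∀ x ∉ U, F x = 0 :=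
  ⟨_, isLocallyConstant_extend_zero hU hf hfs, hasCompactSupport_extend_zero hfs, tsupport_extend_zero_subset_self hfs,
    extend_zero_apply_coe f, fun _ hx => extend_zero_apply_of_not_mem f hx⟩

end ExtendZero

/-! ## §2 (L2) Restriction to a closed set -/

section Restrict

variable {X : Type*} [TopologicalSpace X] {Y : Type*} [Zero Y]

omit [Zero Y] in
/-- Restriction of a locally constant function to a subspace is locally constant. [cite: BernsteinZelevinsky1976, §1.1] -/
theorem isLocallyConstant_comp_subtypeVal {A : Set X} {F : X → Y} (hF : IsLocallyConstant F) :
    IsLocallyConstant (F ∘ (Subtype.val : ↥A → X)) :=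
  hF.comp_continuous continuous_subtype_val

/-- **(L2)** Restriction of a compactly supported function to a CLOSED subspace has compact support (a closed embedding is proper).
[cite: BernsteinZelevinsky1976, §1.3 Prop. 1.8] -/
theorem hasCompactSupport_comp_subtypeVal_of_isClosed {Z : Set X} (hZ : IsClosed Z) {F : X → Y} (hFs : HasCompactSupport F) :
    HasCompactSupport (F ∘ (Subtype.val : ↥Z → X)) :=
  hFs.comp_isClosedEmbedding hZ.isClosedEmbedding_subtypeVal

end Restrict

/-! ## §3 (L3) The kernel: vanishing on `Z` ⟺ support off `Z`; exactness in the middle; uniqueness (⇒ (L5) equivariance) -/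

section Kernel

variable {X : Type*} [TopologicalSpace X] {Y : Type*} [Zero Y]

/-- **The support of a locally constant function is closed**: `tsupport F = support F`. [cite: BernsteinZelevinsky1976, §1.1] -/
theorem tsupport_eq_support_of_isLocallyConstant {F : X → Y} (hF : IsLocallyConstant F) : tsupport F = Function.support F := by
  rw [tsupport, (show IsClosed (Function.support F) from ?_).closure_eq]
  rw [← isOpen_compl_iff, show (Function.support F)ᶜ = F ⁻¹' {0} from by ext x; simp [Function.mem_support]]
  exact hF.isOpen_fiber 0

/-- **(L3)** A locally constant `F` vanishing ON `Z` has `tsupport F` disjoint from `Z`. [cite: BernsteinZelevinsky1976, §1.3 Prop. 1.8] -/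
theorem disjoint_tsupport_of_forall_mem_eq_zero {F : X → Y} (hF : IsLocallyConstant F) {Z : Set X} (h : ∀ x ∈ Z, F x = 0) :
    Disjoint (tsupport F) Z := by
  rw [tsupport_eq_support_of_isLocallyConstant hF, Set.disjoint_left]
  exact fun x hx hxZ => hx (h x hxZ)

/-- Conversely, a function vanishes on any set disjoint from its `tsupport`. [cite: BernsteinZelevinsky1976, §1.3 Prop. 1.8] -/
theorem forall_mem_eq_zero_of_disjoint_tsupport {F : X → Y} {Z : Set X} (h : Disjoint (tsupport F) Z) : ∀ x ∈ Z, F x = 0 :=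
  fun _ hx => image_eq_zero_of_notMem_tsupport fun hx' => Set.disjoint_left.1 h hx' hx

/-- The restriction to the open complement of a locally constant compactly supported `F` vanishing on the (closed) `Z` lies in `S(Zᶜ)`: compact support in the
subspace `Zᶜ` (its support is the compact `tsupport F ⊆ Zᶜ`). [cite: BernsteinZelevinsky1976, §1.3 Prop. 1.8] -/
theorem hasCompactSupport_comp_subtypeVal_compl_of_forall_mem_eq_zero {F : X → Y} (hF : IsLocallyConstant F) (hFs : HasCompactSupport F) {Z : Set X}
    (h : ∀ x ∈ Z, F x = 0) : HasCompactSupport (F ∘ (Subtype.val : ↥Zᶜ → X)) := by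
  have hdisj := disjoint_tsupport_of_forall_mem_eq_zero hF h
  -- `tsupport F` is a compact subset of `Zᶜ`; its preimage in the subtype is compact and contains the support of the restriction
  have hsub : tsupport F ⊆ Zᶜ := fun x hx hxZ => Set.disjoint_left.1 hdisj hx hxZ
  have hK : IsCompact ((Subtype.val : ↥Zᶜ → X) ⁻¹' tsupport F) :=
    (Topology.IsInducing.subtypeVal).isCompact_preimage' hFs (by rwa [Subtype.range_coe])
  refine HasCompactSupport.intro' hK ((isClosed_tsupport F).preimage continuous_subtype_val) fun x hx => ?_
  exact image_eq_zero_of_notMem_tsupport (f := F) (show (x : X) ∉ tsupport F from hx)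

end Kernel

/-! ## §4 (L4) The relative lift for a closed pair `Z' ⊆ Z` -/

section RelativeLift

variable {X : Type*} [TopologicalSpace X] [T2Space X] {Y : Type*} [Zero Y]

/-- **Extension by zero INSIDE `Z` across a closed `Z'`**: `f ∈ S(Z ∖ Z')` extends by zero to a locally constant compactly supported `g : ↥Z → Y` vanishing on `Z'`.
[cite: BernsteinZelevinsky1976, §1.3 Prop. 1.8] -/
theorem exists_extend_zero_sdiff {Z Z' : Set X} (hZ' : IsClosed Z') {f : ↥(Z \ Z') → Y} (hf : IsLocallyConstant f) (hfs : HasCompactSupport f) :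
    ∃ g : ↥Z → Y, IsLocallyConstant g ∧ HasCompactSupport g ∧ (∀ x : ↥(Z \ Z'), g ⟨x, x.2.1⟩ = f x) ∧ ∀ x : ↥Z, (x : X) ∈ Z' → g x = 0 := by
  classical
  -- the inclusion `ι : ↥(Z ∖ Z') → ↥Z` is an open embedding with range `{x | ↑x ∉ Z'}`
  let ι : ↥(Z \ Z') → ↥Z := fun x => ⟨x, x.2.1⟩
  have hιemb : Topology.IsEmbedding ι := Topology.IsEmbedding.inclusion fun x hx => hx.1
  have hιrange : Set.range ι = {x : ↥Z | (x : X) ∉ Z'} := by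
    ext x
    constructor
    · rintro ⟨y, rfl⟩; exact y.2.2
    · intro hx; exact ⟨⟨x, x.2, hx⟩, rfl⟩
  have hιopen : IsOpen (Set.range ι) := by
    rw [hιrange]
    exact (hZ'.preimage continuous_subtype_val).isOpen_compl
  have hι : Topology.IsOpenEmbedding ι := ⟨hιemb, hιopen⟩
  -- extension by zero along `ι` (the (L1) construction in the space `↥Z`)
  let g : ↥Z → Y := Function.extend ι f 0
  have hginj : Function.Injective ι := hιemb.injective
  have hgapp : ∀ x, g (ι x) = f x := fun x => hginj.extend_apply _ _ _
  have hgzero : ∀ x : ↥Z, x ∉ Set.range ι → g x = 0 := fun x hx => by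
    show Function.extend ι f 0 x = 0
    rw [Function.extend_apply' _ _ _ (fun ⟨y, hy⟩ => hx ⟨y, hy⟩)]; rfl
  -- the image `K` of `tsupport f` is compact, hence closed in the Hausdorff `↥Z`, and `g = 0` off `K`
  have hK : IsCompact (ι '' tsupport f) := hfs.image hιemb.continuous
  have hKcl : IsClosed (ι '' tsupport f) := hK.isClosed
  have hgK : ∀ x : ↥Z, x ∉ ι '' tsupport f → g x = 0 := by
    intro x hx
    by_cases hxr : x ∈ Set.range ι
    · obtain ⟨y, rfl⟩ := hxr
      rw [hgapp]
      exact image_eq_zero_of_notMem_tsupport fun h => hx ⟨y, h, rfl⟩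
    · exact hgzero x hxr
  refine ⟨g, ?_, ?_, fun x => hgapp x, fun x hx => hgzero x (by rw [hιrange]; exact fun h => h hx)⟩
  · -- locally constant: near a point of the open range, `g = f ∘ ι⁻¹`; off the closed `K`, `g = 0`
    refine (IsLocallyConstant.iff_eventually_eq _).2 fun x => ?_
    by_cases hxr : x ∈ Set.range ι
    · obtain ⟨y, rfl⟩ := hxr
      have hev : ∀ᶠ z in 𝓝 y, f z = f y := hf.eventually_eq y
      rw [← hι.map_nhds_eq y, Filter.eventually_map]
      filter_upwards [hev] with z hz
      rw [hgapp, hgapp, hz]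
    · have hxK : x ∉ ι '' tsupport f := fun ⟨y, _, hy⟩ => hxr ⟨y, hy⟩
      filter_upwards [hKcl.isOpen_compl.mem_nhds hxK] with z hz
      rw [hgK z hz, hgK x hxK]
  · exact HasCompactSupport.intro' hK hKcl fun x hx => hgK x hx

variable [LocallyCompactSpace X] [TotallyDisconnectedSpace X]

/-- **(L4) THE RELATIVE LIFT.**  `X` locally compact Hausdorff totally disconnected, `Z' ⊆ Z` with `Z'` closed; every `f ∈ S(Z ∖ Z')` is the restriction of
some `F ∈ S(X)` VANISHING ON `Z'` (extend by zero inside `Z`, then ★ `exists_isLocallyConstant_hasCompactSupport_extend`); in particular `tsupport F ∩ Z' = ∅`.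
[cite: BernsteinZelevinsky1976, §1.3 Prop. 1.8; §1.5] -/
theorem exists_extend_of_sdiff {Y : Type*} [AddCommMonoid Y] {Z Z' : Set X} (hZ' : IsClosed Z') (hZ'Z : Z' ⊆ Z) {f : ↥(Z \ Z') → Y}
    (hf : IsLocallyConstant f) (hfs : HasCompactSupport f) :
    ∃ F : X → Y, IsLocallyConstant F ∧ HasCompactSupport F ∧ (∀ x : ↥(Z \ Z'), F x = f x) ∧ (∀ x ∈ Z', F x = 0) ∧ Disjoint (tsupport F) Z' := by
  obtain ⟨g, hg, hgs, hgf, hg0⟩ := exists_extend_zero_sdiff hZ' hf hfs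
  obtain ⟨F, hF, hFs, hFg⟩ := exists_isLocallyConstant_hasCompactSupport_extend hg hgs
  have h0 : ∀ x ∈ Z', F x = 0 := fun x hx => by rw [show x = ((⟨x, hZ'Z hx⟩ : ↥Z) : X) from rfl, hFg, hg0 _ hx]
  exact ⟨F, hF, hFs, fun x => by rw [show (x : X) = ((⟨x, x.2.1⟩ : ↥Z) : X) from rfl, hFg, hgf], h0,
    disjoint_tsupport_of_forall_mem_eq_zero hF h0⟩

end RelativeLift

end Literature.Topology
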